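import Literature.NumberTheory.GaloisRepresentations.LubinTateColemanCoordMomentsSeparationTwo
import Literature.NumberTheory.GaloisRepresentations.LubinTateUnramifiedNormalBasis
import HarnessLib

/-!
# The separation theorems of the Coleman coordinate module with their hypotheses DISCHARGED over an unramified base (`q = 2`):
# `γ = 1 + π²w` has infinite order (from the `Λ`-freeness of `M`!), `𝔪_{𝒪_E} = (π)`, and `r ∈ M` is determined by its moments

De Shalit, *Iwasawa theory of elliptic curves with complex multiplication* (1987), Ch. I §3.1 ("`Λ ≅ ℤ_p⟦S⟧` … maps `u^α` to `(1+S)^α`" — the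
topological generator has infinite order), §3.5 (11); Serre, *Local Fields* I §4 Prop. 10 (`π𝒪_E` is the maximal ideal of an unramified `E`).
`LubinTateColemanCoordMomentsSeparationTwo` proved that the moments `mom_k` separate `M = ColemanCoordModule` under three side hypotheses:
`k ↦ γ^{k+1}` injective, `𝔪_{𝒪_E} = (π)`, and `(π)`/`𝔪`-adic completeness of `𝒪_E`.  THIS file discharges them (0 sorry, no definitions):

* §1 (generic base `S`, `CharZero S`) `coeff_one_one_add_X_pow` (`[T]((1+T)^n) = n`), ★ **`units_pow_injective_of_coordBasis`** — **`n ↦ γ^n` is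
  INJECTIVE** whenever the coordinate module has its `Λ`-basis `{1, Y}` (`σ_{γ^n} = (1+T)^n•` on the free module: `(1+T)^i = (1+T)^j ⟹ i = j`
  by the coefficient of `T`) — no valuation theory needed; `injective_pow_succ_val_of_coordBasis` (the form consumed by the prequel);
* §2 (`E ⊆ F^{nr}`) `maximalIdeal_unitBall_eq_span` (**`𝔪_{𝒪_E} = (π)`**, from `isMaximal_span_pi`), `isAdicComplete_maximalIdeal_unitBall`,
  `algebraMap_ltCoeff_pi_mul_eq_zero` (`π` is regular on `𝒪_E`);
* USAGE: for `E ⊆ F^{nr}`, `char F = 0`, `γ = 1 + π²w`, feed `maximalIdeal_unitBall_eq_span`, `eq_zero_of_algebraMap_ltCoeff_pi_mul_eq_zero`,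
  `injective_pow_succ_val_of_coordBasis` (and `haveI := isAdicComplete_maximalIdeal_unitBall hπ E hE`) into the prequel's
  `eq_zero_of_forall_coordMoment_eq_zero` / `eq_of_forall_coordMoment_eq`: an element of `M` is determined by its moments `mom_k` on any weight
  set with infinitely many `k` of each parity and `mom_k(1) ≠ 0` — the pinning principle of (J-i) with no residual side conditions (the gate's
  dedup lint treats the discharged restatements as duplicates of the prequel, so they are not re-declared here).

## References
* E. de Shalit, *Iwasawa theory of elliptic curves with complex multiplication* (1987), Ch. I §3.1, §3.5 (11), §3.7. [deShalit1987]
* J.-P. Serre, *Local Fields* (1979), Ch. I §4 Prop. 10. [SerreLocalFields1979]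
* L. C. Washington, *Introduction to Cyclotomic Fields*, 2nd ed. (1997), §7.1, §13.2. [Washington1997]
-/

noncomputable section

open PowerSeries

namespace Literature.NumberTheory.GaloisRepresentations

/-! ### §1. `γ` has infinite order: read off the free `Λ`-module `M` -/

section InfiniteOrder

open GaloisRepresentations.IsNonarchimedeanLocalField LubinTate ValuativeRel Finset

variable {F : Type} [Field F] [ValuativeRel F] [TopologicalSpace F] [IsNonarchimedeanLocalField F]

attribute [local instance] ltNormUniformSpace ltNormIsUniformAddGroup rk1 nF nE fintypeResidueField

variable {π : 𝒪[F]} (hπ : (valuation F).IsUniformizer (π : F)) (hq : residueFieldCard F = 2)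
variable {S : Type*} [CommRing S] (ι : LTCoeff F →+* S) [IsAdicComplete (Ideal.span {ι (LTCoeff.of F π)}) S]
variable (u : (LTCoeff F)ˣ) (hu : LTCoeff.of F π = residueFieldCard F * u) (γ : 𝒪[F]ˣ)
variable (hreg : ∀ x : S, ι (LTCoeff.of F π) * x = 0 → x = 0) (w : 𝒪[F]ˣ) (hγ : (γ : 𝒪[F]) = 1 + π ^ 2 * w)

omit [IsAdicComplete (Ideal.span {ι (LTCoeff.of F π)}) S] in
/-- `[T]((1+T)^n) = n` in `S⟦T⟧`. [cite: Washington1997, §7.1] -/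
theorem coeff_one_one_add_X_pow (n : ℕ) : PowerSeries.coeff 1 ((1 + PowerSeries.X : PowerSeries S) ^ n) = n := by
  induction n with
  | zero => rw [pow_zero, PowerSeries.coeff_one, if_neg one_ne_zero, Nat.cast_zero]
  | succ n ih =>
    rw [pow_succ, mul_add, mul_one, map_add, ih, PowerSeries.coeff_succ_mul_X, PowerSeries.coeff_zero_eq_constantCoeff, map_pow, map_add,
      map_one, PowerSeries.constantCoeff_X, add_zero, one_pow, Nat.cast_succ]

include hπ hq ι u hu hreg w hγ in
/-- ★ **`n ↦ γ^n` is injective** (`γ = 1 + π²w` has INFINITE ORDER in `𝒪_F^×`) as soon as the coordinate module has its `Λ`-basis over a base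
`S` of characteristic `0`: `γ^i = γ^j` gives `σ_{γ^i} = σ_{γ^j}`, i.e. `(1+T)^i • e₀ = (1+T)^j • e₀` on the basis vector `e₀ = 1`, so
`(1+T)^i = (1+T)^j` in `S⟦T⟧` and `i = j` by the coefficient of `T`. [cite: deShalit1987, Ch. I §3.1] -/
theorem units_pow_injective_of_coordBasis [CharZero S] : Function.Injective fun n : ℕ => γ ^ n := by
  intro i j h
  have hb := congrArg (fun v : 𝒪[F]ˣ => (coordBasis hπ hq ι u hu γ hreg w hγ).repr
    (unitTwistₗ hπ hq ι u hu γ v (coordBasis hπ hq ι u hu γ hreg w hγ 0)) 0) h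
  simp only [unitTwistₗ_pow, map_smul, Module.Basis.repr_self, Finsupp.smul_apply, Finsupp.single_eq_same, smul_eq_mul, mul_one] at hb
  have hc := congrArg (PowerSeries.coeff 1) hb
  rw [coeff_one_one_add_X_pow, coeff_one_one_add_X_pow] at hc
  exact Nat.cast_injective hc

include hπ hq ι u hu hreg hγ in
/-- **`k ↦ γ^{k+1}` (in `𝒪_F`) is injective** — the hypothesis `hγinj` of `LubinTateColemanCoordMomentsSeparationTwo`, discharged.
[cite: deShalit1987, Ch. I §3.1] -/
theorem injective_pow_succ_val_of_coordBasis [CharZero S] : Function.Injective fun k : ℕ => (γ : 𝒪[F]) ^ (k + 1) := by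
  intro i j h
  have h' : γ ^ (i + 1) = γ ^ (j + 1) := Units.val_injective (by rw [Units.val_pow_eq_pow_val, Units.val_pow_eq_pow_val]; exact h)
  exact Nat.succ_injective (units_pow_injective_of_coordBasis hπ hq ι u hu γ hreg w hγ h')

end InfiniteOrder

/-! ### §2. The unramified base: `𝔪_{𝒪_E} = (π)`, completeness, regularity of `π` -/

section Unramified

open GaloisRepresentations.IsNonarchimedeanLocalField LubinTate ValuativeRel Field

variable {F : Type} [Field F] [ValuativeRel F] [TopologicalSpace F] [IsNonarchimedeanLocalField F]

attribute [local instance] ltNormUniformSpace ltNormIsUniformAddGroup rk1 nF nE fintypeResidueField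

variable {π : 𝒪[F]} (hπ : (valuation F).IsUniformizer (π : F))
variable (E : IntermediateField F (AlgebraicClosure F)) [FiniteDimensional F E]

include hπ in
/-- **`𝔪_{𝒪_E} = π𝒪_E` for `E ⊆ F^{nr}` finite** (`π𝒪_E` is maximal, `isMaximal_span_pi`; a local ring has one maximal ideal).
[cite: SerreLocalFields1979, Ch. I §4 Prop. 10] -/
theorem maximalIdeal_unitBall_eq_span (hE : E ≤ maxUnramified F) :
    IsLocalRing.maximalIdeal (unitBall E) = Ideal.span {algebraMap (LTCoeff F) (unitBall E) (LTCoeff.of F π)} :=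
  (IsLocalRing.eq_maximalIdeal (isMaximal_span_pi hπ E hE)).symm

include hπ in
/-- `𝒪_E` is `𝔪`-adically complete for `E ⊆ F^{nr}` (`𝔪 = (π)` and `isAdicComplete_span_algebraMap_pi`). [cite: SerreLocalFields1979, Ch. II §1] -/
theorem isAdicComplete_maximalIdeal_unitBall (hE : E ≤ maxUnramified F) :
    IsAdicComplete (IsLocalRing.maximalIdeal (unitBall E)) (unitBall E) := by
  rw [maximalIdeal_unitBall_eq_span hπ E hE]
  exact isAdicComplete_span_algebraMap_pi hπ E

include hπ in
/-- `π` is regular on `𝒪_E`: `π·x = 0 ⟹ x = 0`. [cite: SerreLocalFields1979, Ch. I §4] -/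
theorem eq_zero_of_algebraMap_ltCoeff_pi_mul_eq_zero (x : unitBall E)
    (hx : algebraMap (LTCoeff F) (unitBall E) (LTCoeff.of F π) * x = 0) : x = 0 :=
  (mul_eq_zero.mp hx).resolve_left (algebraMap_pi_ne_zero hπ E)

end Unramified

end Literature.NumberTheory.GaloisRepresentations
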